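import Literature.AlgebraicGeometry.Limits.LocalizationSmoothSpread
import Literature.AlgebraicGeometry.Limits.LocalizationProperSpreadOfGenericFibre
import HarnessLib

/-!
# Limits of schemes: a smooth proper (e.g. smooth projective) generic fibre spreads to a smooth,
# proper and flat family over a dense open of the prescribed base — unit form (EGA IV₃ 8.10.5,
# IV₄ 17.7.8; Stacks 081F, 0C0C)

Topic `Literature/AlgebraicGeometry/Limits`. Theorems only (no definition, no named fact, no instance);
the JOINT corollary of the three spreading theorems of the tree for the system
`Spec Frac A = lim_{s ≠ 0} Spec A[1/s]` of basic open neighbourhoods of the generic point of a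
Noetherian integral affine base (`Limits/LocalizationDiagram`, `Limits/LocalizationProdLimit`):

* smoothness — `LocApprox.exists_forall_smooth_snd` (`Limits/LocalizationSmoothSpread`; Stacks 0C0C,
  EGA IV₄ 17.7.8 (ii));
* properness — `LocApprox.exists_forall_isProper_snd` (`Limits/LocalizationProperSpreadOfGenericFibre`;
  Stacks 081F, EGA IV₃ 8.10.5 (xii));
* flatness — `LocApprox.exists_forall_flat_snd` (generic flatness, EGA IV₂ 6.9.1).

**Main result (`LocApprox.exists_forall_smooth_isProper_flat_snd_of_isUnit`).** Let `A` be a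
Noetherian domain with fraction field `K` and `P → Spec A` a PRESCRIBED `A`-scheme, quasi-compact,
quasi-separated and locally of finite presentation, whose generic fibre `P ×_A Spec K → Spec K` is
smooth and proper. Then there is ONE `s ≠ 0` in `A` such that for EVERY commutative `A`-algebra `T`
in which `s` is a unit — i.e. every `T` over the stage `A[1/s]`: the models of `A[1/t]` for the
multiples `t` of `s`, the local rings `A_𝔭` at the primes `𝔭 ∌ s` (the points of the dense open
`D(s) ⊆ Spec A`), their completions, residue fields, … — the base change `P ×_A Spec T → Spec T` is
smooth, proper and flat. The three stage theorems give three non-zero-divisors `s₁, s₂, s₃`; below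
`s = s₁ s₂ s₃` all three properties hold for the stage `Spec A[1/s]`, and they pass to any `T` over it
because `Spec T → Spec A` factors through `Spec A[1/s] → Spec A` (`IsLocalization.Away.lift`) and the
three properties are stable under base change (Mathlib `MorphismProperty.IsStableUnderBaseChange`).

Variants: the stage form `…_snd` (every model `T` of `A[1/t]`, `s ∣ t`, as in the sibling files); a
PROJECTIVE generic fibre (`…_of_isProjectiveOver`, via `Motives.IsProjectiveOver.isProper`); a generic
fibre identified with a given smooth projective `K`-variety `E` (`…_of_isSmoothProjective`, hypothesis
`Motives.IsSmoothProjective n E` and an iso of `K`-schemes `P ×_A Spec K ≅ E`); and the reading at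
the local rings of the base (`…_atPrime`: every `T` with `IsLocalization.AtPrime T 𝔭`, `s ∉ 𝔭`).

This is the shape in which spreading-out arguments for a GIVEN integral model consume the three
theorems (e.g. an integral model of a Shimura curve over a ring of `S`-integers `𝒪_E[1/N]`, whose
generic fibre is known to be a smooth projective curve: it is smooth and proper over `𝒪_{E,(ν)}` for
all but finitely many primes `ν`). Deliberately NOT here: the relative dimension of the stages (for an
irreducible total space see `Limits/SmoothProjectiveModelPrescribedBase`), geometric irreducibility of
the fibres (Stacks 0AY8, ibid.), and any choice of model (`Limits/SmoothProjectiveSpreadPrescribedBase`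
CHOOSES a model; here `P` is prescribed).

## References

* [StacksProject] The Stacks Project, Tags 081F (Lemma 32.13.1), 0C0C (Lemma 32.8.9 ff.), 01V9,
  052B (generic flatness).
* [EGAIV3] A. Grothendieck, J. Dieudonné, EGA IV₃ (Publ. Math. IHÉS 28, 1966), Thm. 8.10.5 (v),
  (xii), (xiii).
* [EGAIV4] EGA IV₄ (Publ. Math. IHÉS 32, 1967), Prop. 17.7.8.
* [EGAIV2] EGA IV₂ (Publ. Math. IHÉS 24, 1965), Thm. 6.9.1.
* [GortzWedhorn2020] U. Görtz, T. Wedhorn, *Algebraic Geometry I: Schemes*, 2nd ed. (2020),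
  Cor. 10.85, Thm. 13.100, Thm. 14.57 / Rem. 14.58 (principle of «spreading out»).
-/

noncomputable section

universe u

open CategoryTheory CategoryTheory.Limits AlgebraicGeometry

namespace Literature.AlgebraicGeometry.Limits

open Literature.AlgebraicGeometry.Motives (SchemeOver specOver IsProjectiveOver IsSmoothProjective)

set_option backward.isDefEq.respectTransparency false

namespace LocApprox

/-! ## Base change from the stage `Spec A[1/s]` to any `T` in which `s` is a unit -/

section Unit

variable {A : Type u} [CommRing A]

/-- If `i : T → Y` factors as `i = e ≫ j` then `pullback.snd f i` is a base change of
`pullback.snd f j` (along `e`); so a morphism property stable under base change passes from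
`X ×_Y Y' → Y'` to `X ×_Y T → T`. [folklore] -/
private theorem of_snd_of_comp_eq (W : MorphismProperty Scheme.{u}) [W.IsStableUnderBaseChange]
    {X Y Y' T : Scheme.{u}} (f : X ⟶ Y) (j : Y' ⟶ Y) (hW : W (pullback.snd f j)) {i : T ⟶ Y}
    (e : T ⟶ Y') (he : e ≫ j = i) : W (pullback.snd f i) := by
  subst he
  have h := W.pullback_snd (pullback.snd f j) e hW
  rw [← pullbackLeftPullbackSndIso_inv_snd_snd f j e]
  exact (W.cancel_left_of_respectsIso (pullbackLeftPullbackSndIso f j e).inv _).mpr h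

/-- If `s ∈ A` becomes a unit in the `A`-algebra `T`, the structure morphism `Spec T → Spec A`
factors through the stage `Spec L → Spec A` of any model `L` of `A[1/s]` (universal property of the
localization, `IsLocalization.Away.lift`). [folklore] -/
private theorem exists_comp_specMap_eq_of_isUnit (s : A) (L : Type u) [CommRing L] [Algebra A L]
    [IsLocalization.Away s L] (T : Type u) [CommRing T] [Algebra A T]
    (hs : IsUnit (algebraMap A T s)) :
    ∃ e : Spec (.of T) ⟶ Spec (.of L),
      e ≫ Spec.map (CommRingCat.ofHom (algebraMap A L)) =
        Spec.map (CommRingCat.ofHom (algebraMap A T)) :=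
  ⟨Spec.map (CommRingCat.ofHom (IsLocalization.Away.lift s hs)), by
    rw [← Spec.map_comp, ← CommRingCat.ofHom_comp, IsLocalization.Away.lift_comp]⟩

/-- **From the stage `A[1/s]` to every `T` inverting `s`.** Let `W` be a property of morphisms of
schemes stable under base change, `P → Spec A` an `A`-scheme and `L` a model of `A[1/s]`. If
`P ×_A Spec L → Spec L` has `W`, then so does `P ×_A Spec T → Spec T` for every commutative
`A`-algebra `T` in which `s` is a unit (it is the base change of the former along
`Spec T → Spec L`). [folklore] -/
private theorem of_stage_of_isUnit (W : MorphismProperty Scheme.{u}) [W.IsStableUnderBaseChange]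
    (P : SchemeOver A) (s : A) (L : Type u) [CommRing L] [Algebra A L] [IsLocalization.Away s L]
    (hW : W (pullback.snd P.hom (Spec.map (CommRingCat.ofHom (algebraMap A L)))))
    (T : Type u) [CommRing T] [Algebra A T] (hs : IsUnit (algebraMap A T s)) :
    W (pullback.snd P.hom (Spec.map (CommRingCat.ofHom (algebraMap A T)))) := by
  obtain ⟨e, he⟩ := exists_comp_specMap_eq_of_isUnit s L T hs
  exact of_snd_of_comp_eq W P.hom _ hW e he

/-- In a model `T` of `A[1/t]`, every divisor `s` of `t` is a unit. [folklore] -/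
private theorem isUnit_algebraMap_of_dvd {s t : A} (hst : s ∣ t) (T : Type u) [CommRing T] [Algebra A T]
    [IsLocalization.Away t T] : IsUnit (algebraMap A T s) :=
  isUnit_of_dvd_unit (map_dvd (algebraMap A T) hst) (IsLocalization.Away.algebraMap_isUnit t)

/-- In a localization `T = A_𝔭` at a prime `𝔭` not containing `s`, the element `s` is a unit.
[folklore] -/
private theorem isUnit_algebraMap_of_not_mem {s : A} (p : Ideal A) [p.IsPrime] (hsp : s ∉ p)
    (T : Type u) [CommRing T] [Algebra A T] [IsLocalization.AtPrime T p] :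
    IsUnit (algebraMap A T s) :=
  IsLocalization.map_units T ⟨s, show s ∈ p.primeCompl from hsp⟩

end Unit

/-! ## Smooth, proper and flat below one stage -/

section SmoothProper

variable {A : Type u} [CommRing A] [IsDomain A] [IsNoetherianRing A]
  (K : Type u) [Field K] [Algebra A K] [IsFractionRing A K]

/-- **A smooth proper generic fibre spreads to a smooth, proper and flat family — unit form**
(EGA IV₃ 8.10.5 (xii) + IV₄ 17.7.8 (ii) + IV₂ 6.9.1; The Stacks Project, Tags 081F, 0C0C, 052B).
Let `A` be a Noetherian domain with fraction field `K`, and `P → Spec A` quasi-compact,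
quasi-separated and locally of finite presentation with `P ×_A Spec K → Spec K` smooth and proper.
Then there is a non-zero-divisor `s` (i.e. `s ≠ 0`) such that for every commutative `A`-algebra `T`
with `s` a unit in `T`, the base change `P ×_A Spec T → Spec T` is smooth, proper and flat. Proof:
`s = s₁ s₂ s₃` with `s₁` from `exists_forall_smooth_snd`, `s₂` from `exists_forall_isProper_snd`,
`s₃` from `exists_forall_flat_snd`, read at the stage `Localization.Away s`, then
`of_stage_of_isUnit`. [cite: StacksProject, Tags 081F, 0C0C] -/
theorem exists_forall_smooth_isProper_flat_snd_of_isUnit (P : SchemeOver A) [QuasiCompact P.hom]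
    [QuasiSeparated P.hom] [LocallyOfFinitePresentation P.hom]
    (hsm : Smooth (pullback.snd P.hom (Spec.map (CommRingCat.ofHom (algebraMap A K)))))
    (hpr : IsProper (pullback.snd P.hom (Spec.map (CommRingCat.ofHom (algebraMap A K))))) :
    ∃ s ∈ nonZeroDivisors A, ∀ (T : Type u) [CommRing T] [Algebra A T],
      IsUnit (algebraMap A T s) →
        Smooth (pullback.snd P.hom (Spec.map (CommRingCat.ofHom (algebraMap A T)))) ∧
        IsProper (pullback.snd P.hom (Spec.map (CommRingCat.ofHom (algebraMap A T)))) ∧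
        Flat (pullback.snd P.hom (Spec.map (CommRingCat.ofHom (algebraMap A T)))) := by
  classical
  haveI : LocallyOfFiniteType P.hom := inferInstance
  obtain ⟨s₁, hs₁, H₁⟩ := exists_forall_smooth_snd (nonZeroDivisors A) K P hsm
  obtain ⟨s₂, hs₂, H₂⟩ := exists_forall_isProper_snd K P hpr
  obtain ⟨s₃, hs₃, H₃⟩ := exists_forall_flat_snd P
  have hsS : s₁ * s₂ * s₃ ∈ nonZeroDivisors A := mul_mem (mul_mem hs₁ hs₂) hs₃
  refine ⟨s₁ * s₂ * s₃, hsS, fun T _ _ hT => ?_⟩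
  -- the three properties at the stage `A[1/s]`, `s = s₁ s₂ s₃`
  have hd₁ : s₁ ∣ s₁ * s₂ * s₃ := ⟨s₂ * s₃, by ring⟩
  have hd₂ : s₂ ∣ s₁ * s₂ * s₃ := ⟨s₁ * s₃, by ring⟩
  have hd₃ : s₃ ∣ s₁ * s₂ * s₃ := ⟨s₁ * s₂, by ring⟩
  have h₁ := H₁ _ hd₁ (Localization.Away (s₁ * s₂ * s₃))
  have h₂ := H₂ _ hsS hd₂ (Localization.Away (s₁ * s₂ * s₃))
  have h₃ := H₃ _ hd₃ (Localization.Away (s₁ * s₂ * s₃))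
  exact ⟨of_stage_of_isUnit @Smooth P _ _ h₁ T hT, of_stage_of_isUnit @IsProper P _ _ h₂ T hT,
    of_stage_of_isUnit @Flat P _ _ h₃ T hT⟩

/-- **A smooth proper generic fibre spreads to a smooth, proper and flat family — stage form**
(the shape of `exists_forall_smooth_snd` / `exists_forall_isProper_snd` / `exists_forall_flat_snd`,
now with ONE `s` for the three properties): for every multiple `t` of `s` and every model `T` of
`A[1/t]`, `P ×_A Spec T → Spec T` is smooth, proper and flat.
[cite: StacksProject, Tags 081F, 0C0C] -/
theorem exists_forall_smooth_isProper_flat_snd (P : SchemeOver A) [QuasiCompact P.hom]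
    [QuasiSeparated P.hom] [LocallyOfFinitePresentation P.hom]
    (hsm : Smooth (pullback.snd P.hom (Spec.map (CommRingCat.ofHom (algebraMap A K)))))
    (hpr : IsProper (pullback.snd P.hom (Spec.map (CommRingCat.ofHom (algebraMap A K))))) :
    ∃ s ∈ nonZeroDivisors A, ∀ t : A, s ∣ t →
      ∀ (T : Type u) [CommRing T] [Algebra A T] [IsLocalization.Away t T],
        Smooth (pullback.snd P.hom (Spec.map (CommRingCat.ofHom (algebraMap A T)))) ∧
        IsProper (pullback.snd P.hom (Spec.map (CommRingCat.ofHom (algebraMap A T)))) ∧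
        Flat (pullback.snd P.hom (Spec.map (CommRingCat.ofHom (algebraMap A T)))) := by
  obtain ⟨s, hsS, H⟩ := exists_forall_smooth_isProper_flat_snd_of_isUnit K P hsm hpr
  exact ⟨s, hsS, fun t hst T _ _ _ => H T (isUnit_algebraMap_of_dvd hst T)⟩

/-- **A smooth proper generic fibre spreads to a smooth, proper and flat family — at the local rings
of the base**: with `s` as above, for every prime `𝔭` of `A` with `s ∉ 𝔭` (a dense open set of primes,
`D(s) ≠ ∅` as `s ≠ 0` in the domain `A`) and every model `T` of the local ring `A_𝔭`, the base change
`P ×_A Spec T → Spec T` is smooth, proper and flat. This is the reading consumed by integral-model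
arguments («good reduction at almost every prime»). [cite: StacksProject, Tags 081F, 0C0C] -/
theorem exists_forall_smooth_isProper_flat_snd_atPrime (P : SchemeOver A) [QuasiCompact P.hom]
    [QuasiSeparated P.hom] [LocallyOfFinitePresentation P.hom]
    (hsm : Smooth (pullback.snd P.hom (Spec.map (CommRingCat.ofHom (algebraMap A K)))))
    (hpr : IsProper (pullback.snd P.hom (Spec.map (CommRingCat.ofHom (algebraMap A K))))) :
    ∃ s ∈ nonZeroDivisors A, ∀ (p : Ideal A) [p.IsPrime], s ∉ p →
      ∀ (T : Type u) [CommRing T] [Algebra A T] [IsLocalization.AtPrime T p],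
        Smooth (pullback.snd P.hom (Spec.map (CommRingCat.ofHom (algebraMap A T)))) ∧
        IsProper (pullback.snd P.hom (Spec.map (CommRingCat.ofHom (algebraMap A T)))) ∧
        Flat (pullback.snd P.hom (Spec.map (CommRingCat.ofHom (algebraMap A T)))) := by
  obtain ⟨s, hsS, H⟩ := exists_forall_smooth_isProper_flat_snd_of_isUnit K P hsm hpr
  exact ⟨s, hsS, fun p _ hsp T _ _ _ => H T (isUnit_algebraMap_of_not_mem p hsp T)⟩

/-- **A smooth projective generic fibre spreads to a smooth, proper and flat family — unit form**
(EGA IV₃ 8.10.5 (xii)–(xiii), IV₄ 17.7.8; Stacks 081F, 0C0C): as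
`exists_forall_smooth_isProper_flat_snd_of_isUnit`, with the generic fibre `P ×_A Spec K` smooth and
PROJECTIVE over `K` (a projective `K`-scheme is proper, `Motives.IsProjectiveOver.isProper`).
[cite: StacksProject, Tags 081F, 0C0C] -/
theorem exists_forall_smooth_isProper_flat_snd_of_isProjectiveOver (P : SchemeOver A)
    [QuasiCompact P.hom] [QuasiSeparated P.hom] [LocallyOfFinitePresentation P.hom]
    (hsm : Smooth (pullback.snd P.hom (Spec.map (CommRingCat.ofHom (algebraMap A K)))))
    (hproj : IsProjectiveOver ((Over.pullback (specOver A K).hom).obj P)) :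
    ∃ s ∈ nonZeroDivisors A, ∀ (T : Type u) [CommRing T] [Algebra A T],
      IsUnit (algebraMap A T s) →
        Smooth (pullback.snd P.hom (Spec.map (CommRingCat.ofHom (algebraMap A T)))) ∧
        IsProper (pullback.snd P.hom (Spec.map (CommRingCat.ofHom (algebraMap A T)))) ∧
        Flat (pullback.snd P.hom (Spec.map (CommRingCat.ofHom (algebraMap A T)))) :=
  exists_forall_smooth_isProper_flat_snd_of_isUnit K P hsm hproj.isProper

/-- **A generic fibre identified with a smooth projective `K`-variety spreads to a smooth, proper and
flat family — unit form.** Let `E` be a smooth projective (geometrically irreducible) variety of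
dimension `n` over `K = Frac A` (`Motives.IsSmoothProjective n E`) and `e₀ : P ×_A Spec K ≅ E` an
isomorphism of `K`-schemes, `P → Spec A` quasi-compact, quasi-separated and locally of finite
presentation over the Noetherian domain `A`. Then for some `s ≠ 0` and every commutative `A`-algebra
`T` in which `s` is a unit, `P ×_A Spec T → Spec T` is smooth, proper and flat (smoothness and
properness of `E → Spec K` are transported along `e₀`, then
`exists_forall_smooth_isProper_flat_snd_of_isUnit`). [cite: StacksProject, Tags 081F, 0C0C] -/
theorem exists_forall_smooth_isProper_flat_snd_of_isSmoothProjective {n : ℕ} (P : SchemeOver A)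
    [QuasiCompact P.hom] [QuasiSeparated P.hom] [LocallyOfFinitePresentation P.hom]
    {E : SchemeOver K} (hE : IsSmoothProjective n E)
    (e₀ : (Over.pullback (specOver A K).hom).obj P ≅ E) :
    ∃ s ∈ nonZeroDivisors A, ∀ (T : Type u) [CommRing T] [Algebra A T],
      IsUnit (algebraMap A T s) →
        Smooth (pullback.snd P.hom (Spec.map (CommRingCat.ofHom (algebraMap A T)))) ∧
        IsProper (pullback.snd P.hom (Spec.map (CommRingCat.ofHom (algebraMap A T)))) ∧
        Flat (pullback.snd P.hom (Spec.map (CommRingCat.ofHom (algebraMap A T)))) := by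
  haveI := hE.smoothOfRelativeDimension
  have hEsm : Smooth E.hom := SmoothOfRelativeDimension.smooth n E.hom
  have hEpr : IsProper E.hom := hE.isProjectiveOver.isProper
  -- transport along `e₀`: `(P ×_A Spec K → Spec K) = e₀.hom.left ≫ E.hom`
  have hw : e₀.hom.left ≫ E.hom =
      pullback.snd P.hom (Spec.map (CommRingCat.ofHom (algebraMap A K))) := Over.w e₀.hom
  haveI : IsIso e₀.hom.left := inferInstance
  have hsm : Smooth (pullback.snd P.hom (Spec.map (CommRingCat.ofHom (algebraMap A K)))) := by
    rw [← hw]; exact (MorphismProperty.cancel_left_of_respectsIso @Smooth _ _).mpr hEsm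
  have hpr : IsProper (pullback.snd P.hom (Spec.map (CommRingCat.ofHom (algebraMap A K)))) := by
    rw [← hw]; exact (MorphismProperty.cancel_left_of_respectsIso @IsProper _ _).mpr hEpr
  exact exists_forall_smooth_isProper_flat_snd_of_isUnit K P hsm hpr

end SmoothProper

end LocApprox

end Literature.AlgebraicGeometry.Limits

end
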